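import Literature.Probability.RandomPlanarGeometry.StarHullOneStep
import HarnessLib

/-!
# The one-step expansion of `Y = Φ'_B(0)^{5/8}`: a clean `O(uη + u² + |x|³ + u|x|)` remainder

`StarHullOneStep.abs_rpow_sub_stepModel_le_of` bounds `Y' - Y - stepModel` by an explicit but
unwieldy expression. Here, for hulls in a controlled class (`δ₀ ≤ d = Φ'_B(0)`, `B` missing
`ball 0 (8ρ₀)`, `ρ₀ ≤ 1`) and small steps (`u ≤ 1`, `η = stepSize S u ≤ 1`), we dominate it by

  `K(δ₀, ρ₀) · (u η + u² + |x|³ + u |x|)`,    `x = U_u`,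

(`abs_rpow_sub_stepModel_le_clean`), a sum of monomials each of which has mean `O(u^{3/2})` over
a Brownian increment (`E|x|³ = O(u^{3/2})`, `E|x| = O(u^{1/2})`, `E η = O(u^{1/2})`). The point
is that the driver's oscillation `η` only enters multiplied by `u`. All coefficient constants are
dominated by the single `K₁ = stepK δ₀ ρ₀ = 200000/(δ₀ ρ₀⁴)`.

## References

* G. F. Lawler, O. Schramm, W. Werner, *Conformal restriction: the chordal case* (2003),
  Prop. 5.2 (5.3) [LawlerSchrammWerner2003Restriction].
-/

noncomputable section

open Set Filter Metric Function
open _root_.Complex _root_.Topology _root_.Real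
open UpperHalfPlane (upperHalfPlaneSet)
open scoped NNReal

namespace Literature.Probability.RandomPlanarGeometry

namespace Loewner

/-- The master constant `K₁ = 200000/(δ₀ ρ₀⁴)`. [folklore] -/
def stepK (δ₀ ρ₀ : ℝ) : ℝ := 200000 / (δ₀ * ρ₀ ^ 4)

/-- The constant of the clean bound, as a function of `δ₀` and the master constant `K`.
[folklore] -/
def stepKcleanOf (δ₀ K : ℝ) : ℝ :=
  2 * (162 * (δ₀ / 2) ^ (-(19 / 8 : ℝ)) * K ^ 3 + 5 / 8 * δ₀ ^ (-(3 / 8 : ℝ)) * K +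
    15 / 64 * 11 * δ₀ ^ (-(11 / 8 : ℝ)) * K ^ 2)

/-- `K₁` dominates all the coefficient constants when `δ₀, ρ₀ ≤ 1`. [folklore] -/
theorem stepK_spec {δ₀ ρ₀ : ℝ} (hδ0 : 0 < δ₀) (hδ1 : δ₀ ≤ 1) (hρ0 : 0 < ρ₀) (hρ1 : ρ₀ ≤ 1) :
    1 ≤ stepK δ₀ ρ₀ ∧ 1 / ρ₀ ≤ stepK δ₀ ρ₀ ∧ 2 / ρ₀ ^ 2 ≤ stepK δ₀ ρ₀ ∧ 4 / (δ₀ * ρ₀ ^ 2) ≤ stepK δ₀ ρ₀ ∧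
      8 / ρ₀ ^ 3 ≤ stepK δ₀ ρ₀ ∧ 6144 / ρ₀ ^ 3 ≤ stepK δ₀ ρ₀ ∧ 1 / ρ₀ + 1 / ρ₀ ^ 2 ≤ stepK δ₀ ρ₀ := by
  have hK : stepK δ₀ ρ₀ = 200000 / (δ₀ * ρ₀ ^ 4) := rfl
  have hρ2 : ρ₀ ^ 2 ≤ 1 := by nlinarith
  have hρ3 : ρ₀ ^ 3 ≤ ρ₀ ^ 2 := by nlinarith
  have hρ4 : ρ₀ ^ 4 ≤ ρ₀ ^ 3 := by nlinarith
  have hden : δ₀ * ρ₀ ^ 4 ≤ ρ₀ ^ 4 := by nlinarith [pow_pos hρ0 4]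
  have hpos : 0 < δ₀ * ρ₀ ^ 4 := by positivity
  refine ⟨?_, ?_, ?_, ?_, ?_, ?_, ?_⟩ <;> rw [hK]
  · rw [le_div_iff₀ hpos]; nlinarith
  · rw [div_le_div_iff₀ hρ0 hpos]; nlinarith [pow_pos hρ0 3]
  · rw [div_le_div_iff₀ (by positivity) hpos]; nlinarith [pow_pos hρ0 2]
  · rw [div_le_div_iff₀ (by positivity) hpos]; nlinarith [pow_pos hρ0 2, mul_pos hδ0 (pow_pos hρ0 2)]
  · rw [div_le_div_iff₀ (by positivity) hpos]; nlinarith [pow_pos hρ0 3]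
  · rw [div_le_div_iff₀ (by positivity) hpos]; nlinarith [pow_pos hρ0 3]
  · have : 1 / ρ₀ + 1 / ρ₀ ^ 2 = (ρ₀ + 1) / ρ₀ ^ 2 := by field_simp
    rw [this, div_le_div_iff₀ (by positivity) hpos]; nlinarith [pow_pos hρ0 2, mul_pos hδ0 (pow_pos hρ0 2)]

/-- Elementary: `(a + b + c)³ ≤ 9 (a³ + b³ + c³)` for `a, b, c ≥ 0`. [folklore] -/
theorem add_pow_three_le {a b c : ℝ} (ha : 0 ≤ a) (hb : 0 ≤ b) (hc : 0 ≤ c) :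
    (a + b + c) ^ 3 ≤ 9 * (a ^ 3 + b ^ 3 + c ^ 3) := by
  nlinarith [sq_nonneg (a - b), sq_nonneg (b - c), sq_nonneg (a - c), mul_nonneg ha hb, mul_nonneg hb hc,
    mul_nonneg ha hc, mul_nonneg (mul_nonneg ha hb) hc, sq_nonneg (a + b - 2 * c), sq_nonneg (a + c - 2 * b),
    sq_nonneg (b + c - 2 * a)]

/-- **The algebraic domination** behind the clean bound: with `K ≥ 1`, `0 ≤ a ≤ η ≤ 1` (`a = |x|`),
`0 ≤ u ≤ 1`, `r = uη + u² + a³ + ua`, if `R ≤ K r`, `0 ≤ β ≤ K (a + u + r)` and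
`0 ≤ I ≤ K (a² + u + r)`, `0 < δ₀ ≤ d`, then the right-hand side of
`abs_rpow_sub_stepModel_le_of` is `≤ stepKcleanOf δ₀ K · r`. [folklore] -/
theorem stepModel_rhs_le {K a u η R β I d δ₀ : ℝ} (hK : 1 ≤ K) (ha0 : 0 ≤ a) (hu0 : 0 ≤ u) (hu1 : u ≤ 1)
    (hη0 : 0 ≤ η) (hη1 : η ≤ 1) (haη : a ≤ η) (hR0 : 0 ≤ R) (hR : R ≤ K * (u * η + u ^ 2 + a ^ 3 + u * a))
    (hβ0 : 0 ≤ β) (hβ : β ≤ K * (a + u + (u * η + u ^ 2 + a ^ 3 + u * a)))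
    (hI0 : 0 ≤ I) (hI : I ≤ K * (a ^ 2 + u + (u * η + u ^ 2 + a ^ 3 + u * a)))
    (hδ0 : 0 < δ₀) (hδ : δ₀ ≤ d) :
    (d / 2) ^ (-(19 / 8 : ℝ)) * β ^ 3 + 5 / 8 * d ^ (-(3 / 8 : ℝ)) * R +
        15 / 128 * d ^ (-(11 / 8 : ℝ)) * (I * (β + K * a)) ≤
      stepKcleanOf δ₀ K * (u * η + u ^ 2 + a ^ 3 + u * a) := by
  have ha1 : a ≤ 1 := haη.trans hη1
  set r := u * η + u ^ 2 + a ^ 3 + u * a with hr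
  have hK0 : 0 ≤ K := by linarith only [hK]
  -- nonnegative summands of `r`
  have n1 : 0 ≤ u * η := mul_nonneg hu0 hη0
  have n2 : 0 ≤ u ^ 2 := sq_nonneg u
  have n3 : 0 ≤ a ^ 3 := pow_nonneg ha0 3
  have n4 : 0 ≤ u * a := mul_nonneg hu0 ha0
  have hr0 : 0 ≤ r := by linarith only [hr, n1, n2, n3, n4]
  have hua : u * a ≤ r := by linarith only [hr, n1, n2, n3]
  have hu2r : u ^ 2 ≤ r := by linarith only [hr, n1, n3, n4]
  have ha3r : a ^ 3 ≤ r := by linarith only [hr, n1, n2, n4]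
  have hr4 : r ≤ 4 := by
    have h1 : u * η ≤ 1 := mul_le_one₀ hu1 hη0 hη1
    have h2 : a ^ 3 ≤ 1 := pow_le_one₀ ha0 ha1
    have h3 : u ^ 2 ≤ 1 := pow_le_one₀ hu0 hu1
    have h4 : u * a ≤ 1 := mul_le_one₀ hu1 ha0 ha1
    linarith only [hr, h1, h2, h3, h4]
  -- piece 1: `β³ ≤ K³ s³`, `s³ ≤ 9(a³ + u³ + r³) ≤ 162 r`
  have p1 : β ^ 3 ≤ K ^ 3 * (162 * r) := by
    have h1 : β ^ 3 ≤ (K * (a + u + r)) ^ 3 := pow_le_pow_left₀ hβ0 hβ 3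
    have h2 : (a + u + r) ^ 3 ≤ 9 * (a ^ 3 + u ^ 3 + r ^ 3) := add_pow_three_le ha0 hu0 hr0
    have h4 : u ^ 3 ≤ r := by
      have : u ^ 3 ≤ u ^ 2 := by
        have := mul_le_of_le_one_left n2 hu1
        calc u ^ 3 = u * u ^ 2 := by ring
          _ ≤ u ^ 2 := this
      exact this.trans hu2r
    have h5 : r ^ 3 ≤ 16 * r := by
      have : r ^ 2 ≤ 16 := by nlinarith only [hr0, hr4]
      calc r ^ 3 = r * r ^ 2 := by ring
        _ ≤ r * 16 := mul_le_mul_of_nonneg_left this hr0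
        _ = 16 * r := by ring
    rw [mul_pow] at h1
    refine h1.trans (mul_le_mul_of_nonneg_left (h2.trans ?_) (by positivity))
    linarith only [ha3r, h4, h5]
  -- piece 3: `I (β + K a) ≤ 2K²(a² + u + r)s`, `(a² + u + r) s ≤ 12 r`
  have p3 : I * (β + K * a) ≤ 2 * K ^ 2 * (12 * r) := by
    have h1 : β + K * a ≤ 2 * K * (a + u + r) := by
      have : K * a ≤ K * (a + u + r) := mul_le_mul_of_nonneg_left (by linarith only [hu0, hr0]) hK0
      linarith only [hβ, this]
    have ha2 : a ^ 2 ≤ a := by nlinarith only [ha0, ha1]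
    have ha21 : a ^ 2 ≤ 1 := ha2.trans ha1
    have h2 : (a ^ 2 + u + r) * (a + u + r) ≤ 12 * r := by
      have e1 : a ^ 2 * a ≤ r := by
        have : a ^ 2 * a = a ^ 3 := by ring
        rw [this]; exact ha3r
      have e2 : a ^ 2 * u ≤ r := by
        have : a ^ 2 * u ≤ a * u := mul_le_mul_of_nonneg_right ha2 hu0
        have h' : a * u = u * a := mul_comm a u
        linarith only [this, h', hua]
      have e3 : a ^ 2 * r ≤ r := mul_le_of_le_one_left hr0 ha21
      have e5 : u * r ≤ r := mul_le_of_le_one_left hr0 hu1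
      have e6 : r * a ≤ r := mul_le_of_le_one_right hr0 ha1
      have e7 : r * u ≤ r := mul_le_of_le_one_right hr0 hu1
      have e8 : r * r ≤ 4 * r := by
        have := mul_le_mul_of_nonneg_left hr4 hr0
        linarith only [this]
      have e9 : u * u ≤ r := by rw [← sq]; exact hu2r
      have hexp : (a ^ 2 + u + r) * (a + u + r) =
          a ^ 2 * a + a ^ 2 * u + a ^ 2 * r + u * a + u * u + u * r + r * a + r * u + r * r := by ring
      rw [hexp]
      linarith only [e1, e2, e3, hua, e5, e6, e7, e8, e9]
    calc I * (β + K * a) ≤ (K * (a ^ 2 + u + r)) * (2 * K * (a + u + r)) :=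
          mul_le_mul hI h1 (by positivity) (by positivity)
      _ = 2 * K ^ 2 * ((a ^ 2 + u + r) * (a + u + r)) := by ring
      _ ≤ 2 * K ^ 2 * (12 * r) := mul_le_mul_of_nonneg_left h2 (by positivity)
  -- exponents at `d ≥ δ₀`
  have hT1 : (d / 2) ^ (-(19 / 8 : ℝ)) ≤ (δ₀ / 2) ^ (-(19 / 8 : ℝ)) :=
    Real.rpow_le_rpow_of_nonpos (by positivity) (by linarith only [hδ]) (by norm_num)
  have hT2 : d ^ (-(3 / 8 : ℝ)) ≤ δ₀ ^ (-(3 / 8 : ℝ)) := Real.rpow_le_rpow_of_nonpos hδ0 hδ (by norm_num)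
  have hT3 : d ^ (-(11 / 8 : ℝ)) ≤ δ₀ ^ (-(11 / 8 : ℝ)) := Real.rpow_le_rpow_of_nonpos hδ0 hδ (by norm_num)
  have c1 : 0 ≤ (δ₀ / 2) ^ (-(19 / 8 : ℝ)) := Real.rpow_nonneg (by positivity) _
  have c2 : 0 ≤ δ₀ ^ (-(3 / 8 : ℝ)) := Real.rpow_nonneg hδ0.le _
  have c3 : 0 ≤ δ₀ ^ (-(11 / 8 : ℝ)) := Real.rpow_nonneg hδ0.le _
  have q1 : (d / 2) ^ (-(19 / 8 : ℝ)) * β ^ 3 ≤ (δ₀ / 2) ^ (-(19 / 8 : ℝ)) * (K ^ 3 * (162 * r)) :=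
    mul_le_mul hT1 p1 (by positivity) c1
  have q2 : 5 / 8 * d ^ (-(3 / 8 : ℝ)) * R ≤ 5 / 8 * δ₀ ^ (-(3 / 8 : ℝ)) * (K * r) :=
    mul_le_mul (mul_le_mul_of_nonneg_left hT2 (by norm_num)) hR hR0 (by positivity)
  have q3 : 15 / 128 * d ^ (-(11 / 8 : ℝ)) * (I * (β + K * a)) ≤ 15 / 128 * δ₀ ^ (-(11 / 8 : ℝ)) * (2 * K ^ 2 * (12 * r)) :=
    mul_le_mul (mul_le_mul_of_nonneg_left hT3 (by norm_num)) p3 (by positivity) (by positivity)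
  -- the coefficient sum
  have hlhs : (δ₀ / 2) ^ (-(19 / 8 : ℝ)) * (K ^ 3 * (162 * r)) + 5 / 8 * δ₀ ^ (-(3 / 8 : ℝ)) * (K * r) +
      15 / 128 * δ₀ ^ (-(11 / 8 : ℝ)) * (2 * K ^ 2 * (12 * r)) =
      (162 * (δ₀ / 2) ^ (-(19 / 8 : ℝ)) * K ^ 3 + 5 / 8 * δ₀ ^ (-(3 / 8 : ℝ)) * K +
        45 / 16 * δ₀ ^ (-(11 / 8 : ℝ)) * K ^ 2) * r := by ring
  have hrhs : stepKcleanOf δ₀ K * r =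
      (324 * (δ₀ / 2) ^ (-(19 / 8 : ℝ)) * K ^ 3 + 5 / 4 * δ₀ ^ (-(3 / 8 : ℝ)) * K +
        165 / 32 * δ₀ ^ (-(11 / 8 : ℝ)) * K ^ 2) * r := by rw [stepKcleanOf]; ring
  have hcoef : 162 * (δ₀ / 2) ^ (-(19 / 8 : ℝ)) * K ^ 3 + 5 / 8 * δ₀ ^ (-(3 / 8 : ℝ)) * K +
        45 / 16 * δ₀ ^ (-(11 / 8 : ℝ)) * K ^ 2 ≤
      324 * (δ₀ / 2) ^ (-(19 / 8 : ℝ)) * K ^ 3 + 5 / 4 * δ₀ ^ (-(3 / 8 : ℝ)) * K +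
        165 / 32 * δ₀ ^ (-(11 / 8 : ℝ)) * K ^ 2 := by
    have w1 : 0 ≤ (δ₀ / 2) ^ (-(19 / 8 : ℝ)) * K ^ 3 := by positivity
    have w2 : 0 ≤ δ₀ ^ (-(3 / 8 : ℝ)) * K := by positivity
    have w3 : 0 ≤ δ₀ ^ (-(11 / 8 : ℝ)) * K ^ 2 := by positivity
    linarith only [w1, w2, w3]
  have hsum := mul_le_mul_of_nonneg_right hcoef hr0
  rw [← hlhs, ← hrhs] at hsum
  linarith only [q1, q2, q3, hsum]

variable {B : Set ℂ} {ρ₀ : ℝ} {U : ℝ≥0 → ℝ} {u : ℝ≥0} {S : ℝ}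
variable (hB : IsStarHull B) (hU : Continuous U) (hU0 : U 0 = 0) (hu : 0 < u)
  (hS : ∀ v : ℝ≥0, v ≤ u → |U v| ≤ S) (hρ₀ : 0 < ρ₀) (hBρ : Disjoint (ball (0 : ℂ) (8 * ρ₀)) B)
  (hη : stepSize S u ≤ starDeriv B * ρ₀ / 1000)

include hB hU hU0 hu hS hρ₀ hBρ hη in
/-- **The clean one-step bound**: for hulls with `δ₀ ≤ Φ'_B(0)`, missing `ball 0 (8ρ₀)`, `ρ₀ ≤ 1`,
and steps with `u ≤ 1`, `η = stepSize S u ≤ 1`: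

  `|Y' - Y - stepModel d c₂ c₃ u x| ≤ stepKcleanOf δ₀ (stepK δ₀ ρ₀) · (u η + u² + |x|³ + u |x|)`,

`x = U_u`, `Y = Φ'_B(0)^{5/8}`, `Y' = Φ'_{B'}(0)^{5/8}`.
[cite: LawlerSchrammWerner2003Restriction, Prop. 5.2 (5.3)] -/
theorem abs_rpow_sub_stepModel_le_clean (hρ1 : ρ₀ ≤ 1) {δ₀ : ℝ} (hδ0 : 0 < δ₀) (hδ : δ₀ ≤ starDeriv B)
    (hη1 : stepSize S u ≤ 1) (hu1 : (u : ℝ) ≤ 1) :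
    |starDeriv (slidHull U B u) ^ (5 / 8 : ℝ) - starDeriv B ^ (5 / 8 : ℝ) -
        stepModel (starDeriv B) (starJet2 B) (starJet3 B) u (U u)| ≤
      stepKcleanOf δ₀ (stepK δ₀ ρ₀) * (u * stepSize S u + u ^ 2 + |U u| ^ 3 + u * |U u|) := by
  obtain ⟨hUu, -, hη0⟩ := abs_driver_le hB hu hS hρ₀ hη
  obtain ⟨hd0, hd1, -⟩ := starDeriv_spec hB
  have hδ1 : δ₀ ≤ 1 := hδ.trans hd1
  obtain ⟨-, -, hc2, hc3, -⟩ := starJet_spec hB hρ₀ hBρ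
  obtain ⟨hK1, hKρ, hK2, hK4, hK8, hK6144, hK12⟩ := stepK_spec hδ0 hδ1 hρ₀ hρ1
  have hmain := abs_starDeriv_sub_model_le hB hU hU0 hu hS hρ₀ hBρ hη
  obtain ⟨hcrude, hsmall⟩ := abs_starDeriv_sub_le_crude hB hU hU0 hu hS hρ₀ hBρ hη
  -- abbreviations (plain `have`-free names to keep the context light)
  have ha0 : 0 ≤ |U u| := abs_nonneg _
  have hu0 : (0 : ℝ) ≤ u := u.coe_nonneg
  have hK0 : 0 ≤ stepK δ₀ ρ₀ := by linarith only [hK1]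
  have hdpos : 0 < starDeriv B := hd0
  -- (1) `R ≤ K r`
  have hR0 : 0 ≤ 200000 * u * (stepSize S u * ρ₀ + u) / (starDeriv B * ρ₀ ^ 4) + 8 / ρ₀ ^ 3 * |U u| ^ 3 +
      6144 / ρ₀ ^ 3 * u * |U u| := by positivity
  have hRK : 200000 * u * (stepSize S u * ρ₀ + u) / (starDeriv B * ρ₀ ^ 4) + 8 / ρ₀ ^ 3 * |U u| ^ 3 +
      6144 / ρ₀ ^ 3 * u * |U u| ≤
      stepK δ₀ ρ₀ * (u * stepSize S u + u ^ 2 + |U u| ^ 3 + u * |U u|) := by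
    have e1 : 200000 * u * (stepSize S u * ρ₀ + u) / (starDeriv B * ρ₀ ^ 4) ≤ stepK δ₀ ρ₀ * (u * stepSize S u + u ^ 2) := by
      rw [stepK, div_mul_eq_mul_div, div_le_div_iff₀ (by positivity) (by positivity)]
      have h2 : (u : ℝ) * (stepSize S u * ρ₀ + u) ≤ u * stepSize S u + u ^ 2 := by
        have : stepSize S u * ρ₀ ≤ stepSize S u := mul_le_of_le_one_right hη0.le hρ1
        nlinarith only [this, hu0]
      have h3 : δ₀ * ρ₀ ^ 4 ≤ starDeriv B * ρ₀ ^ 4 := mul_le_mul_of_nonneg_right hδ (by positivity)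
      have h4 := mul_le_mul h2 h3 (by positivity) (by positivity)
      nlinarith only [h4]
    have e2 : 8 / ρ₀ ^ 3 * |U u| ^ 3 ≤ stepK δ₀ ρ₀ * |U u| ^ 3 := mul_le_mul_of_nonneg_right hK8 (by positivity)
    have e3 : 6144 / ρ₀ ^ 3 * u * |U u| ≤ stepK δ₀ ρ₀ * (u * |U u|) := by
      rw [mul_assoc]; exact mul_le_mul_of_nonneg_right hK6144 (by positivity)
    have e4 : stepK δ₀ ρ₀ * (u * stepSize S u + u ^ 2) + stepK δ₀ ρ₀ * |U u| ^ 3 + stepK δ₀ ρ₀ * (u * |U u|) =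
        stepK δ₀ ρ₀ * (u * stepSize S u + u ^ 2 + |U u| ^ 3 + u * |U u|) := by ring
    linarith only [e1, e2, e3, e4]
  -- (2) `|P| ≤ K (a + u)` and `β := min (|P| + R) (d/2)`
  have hP : |starJet2 B * U u + starJet3 B * U u ^ 2 / 2 + u * (starJet2 B ^ 2 / (2 * starDeriv B) - 4 / 3 * starJet3 B)| ≤
      stepK δ₀ ρ₀ * (|U u| + u) := by
    have e1 : |starJet2 B * U u| ≤ 1 / ρ₀ * |U u| := by
      rw [abs_mul]; exact mul_le_mul_of_nonneg_right hc2 ha0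
    have e2 : |starJet3 B * U u ^ 2 / 2| ≤ 1 / ρ₀ ^ 2 * |U u| := by
      rw [abs_div, abs_mul, abs_pow, abs_two]
      have hx2 : |U u| ^ 2 ≤ |U u| := by
        have : |U u| ≤ 1 := hUu.trans hη1
        nlinarith only [this, ha0]
      have h' := mul_le_mul hc3 hx2 (by positivity) (by positivity)
      have h'' : 2 / ρ₀ ^ 2 * |U u| / 2 = 1 / ρ₀ ^ 2 * |U u| := by ring
      rw [← h'']
      exact div_le_div_of_nonneg_right h' (by norm_num)
    have e3 : |(u : ℝ) * (starJet2 B ^ 2 / (2 * starDeriv B) - 4 / 3 * starJet3 B)| ≤ 4 / (δ₀ * ρ₀ ^ 2) * u := by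
      rw [abs_mul, abs_of_nonneg hu0, mul_comm]
      refine mul_le_mul_of_nonneg_right ((abs_sub _ _).trans ?_) hu0
      have f1 : |starJet2 B ^ 2 / (2 * starDeriv B)| ≤ 1 / (δ₀ * ρ₀ ^ 2) := by
        rw [abs_div, abs_of_pos (by positivity : (0:ℝ) < 2 * starDeriv B), abs_of_nonneg (sq_nonneg _),
          div_le_div_iff₀ (by positivity) (by positivity)]
        have g1 : starJet2 B ^ 2 ≤ (1 / ρ₀) ^ 2 := by rw [← sq_abs]; exact pow_le_pow_left₀ (abs_nonneg _) hc2 2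
        have g2 : starJet2 B ^ 2 * (δ₀ * ρ₀ ^ 2) ≤ (1 / ρ₀) ^ 2 * (δ₀ * ρ₀ ^ 2) := mul_le_mul_of_nonneg_right g1 (by positivity)
        have g3 : (1 / ρ₀) ^ 2 * (δ₀ * ρ₀ ^ 2) = δ₀ := by field_simp
        have g4 : δ₀ ≤ 1 * (2 * starDeriv B) := by linarith only [hδ, hd0]
        linarith only [g2, g3, g4]
      have f2 : |4 / 3 * starJet3 B| ≤ 3 / (δ₀ * ρ₀ ^ 2) := by
        rw [abs_mul, show |(4:ℝ) / 3| = 4 / 3 by norm_num]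
        have g1 := mul_le_mul_of_nonneg_left hc3 (by norm_num : (0:ℝ) ≤ 4 / 3)
        have g2 : 4 / 3 * (2 / ρ₀ ^ 2) ≤ 3 / (δ₀ * ρ₀ ^ 2) := by
          rw [← mul_div_assoc, div_le_div_iff₀ (by positivity) (by positivity)]
          have : δ₀ * ρ₀ ^ 2 ≤ ρ₀ ^ 2 := mul_le_of_le_one_left (by positivity) hδ1
          nlinarith only [this, pow_pos hρ₀ 2]
        linarith only [g1, g2]
      have f3 : 1 / (δ₀ * ρ₀ ^ 2) + 3 / (δ₀ * ρ₀ ^ 2) = 4 / (δ₀ * ρ₀ ^ 2) := by ring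
      linarith only [f1, f2, f3]
    have e4 := abs_add_three (starJet2 B * U u) (starJet3 B * U u ^ 2 / 2)
      ((u : ℝ) * (starJet2 B ^ 2 / (2 * starDeriv B) - 4 / 3 * starJet3 B))
    have e5 : (1 / ρ₀ + 1 / ρ₀ ^ 2) * |U u| ≤ stepK δ₀ ρ₀ * |U u| := mul_le_mul_of_nonneg_right hK12 ha0
    have e6 : 4 / (δ₀ * ρ₀ ^ 2) * u ≤ stepK δ₀ ρ₀ * u := mul_le_mul_of_nonneg_right hK4 hu0
    have e7 : (1 / ρ₀ + 1 / ρ₀ ^ 2) * |U u| = 1 / ρ₀ * |U u| + 1 / ρ₀ ^ 2 * |U u| := by ring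
    have e8 : stepK δ₀ ρ₀ * (|U u| + u) = stepK δ₀ ρ₀ * |U u| + stepK δ₀ ρ₀ * u := by ring
    linarith only [e1, e2, e3, e4, e5, e6, e7, e8]
  have hβ : |starDeriv (slidHull U B u) - starDeriv B| ≤
      stepK δ₀ ρ₀ * (|U u| + u + (u * stepSize S u + u ^ 2 + |U u| ^ 3 + u * |U u|)) := by
    have h1 := abs_sub_abs_le_abs_sub (starDeriv (slidHull U B u) - starDeriv B)
      (starJet2 B * U u + starJet3 B * U u ^ 2 / 2 + u * (starJet2 B ^ 2 / (2 * starDeriv B) - 4 / 3 * starJet3 B))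
    have h2 : stepK δ₀ ρ₀ * (|U u| + u + (u * stepSize S u + u ^ 2 + |U u| ^ 3 + u * |U u|)) =
        stepK δ₀ ρ₀ * (|U u| + u) + stepK δ₀ ρ₀ * (u * stepSize S u + u ^ 2 + |U u| ^ 3 + u * |U u|) := by ring
    linarith only [h1, hmain, hRK, hP, h2]
  have hβd : |starDeriv (slidHull U B u) - starDeriv B| ≤ starDeriv B / 2 := by linarith only [hcrude, hsmall, hd0]
  -- (3) the real-variable lemma with `η := |x|` and `β := min (K s) (d/2)`
  have key := abs_rpow_sub_stepModel_le_of (u := u) hd0 hρ₀ (le_refl |U u|) hc2 hc3 hmain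
    (β := min (stepK δ₀ ρ₀ * (|U u| + u + (u * stepSize S u + u ^ 2 + |U u| ^ 3 + u * |U u|))) (starDeriv B / 2))
    (le_min hβ hβd) (min_le_right _ _)
  -- (4) the pieces
  have hI0 : 0 ≤ 2 / ρ₀ ^ 2 * |U u| ^ 2 + u * (1 / (starDeriv B * ρ₀ ^ 2) + 3 / ρ₀ ^ 2) +
      (200000 * u * (stepSize S u * ρ₀ + u) / (starDeriv B * ρ₀ ^ 4) + 8 / ρ₀ ^ 3 * |U u| ^ 3 +
        6144 / ρ₀ ^ 3 * u * |U u|) := by positivity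
  have hI : 2 / ρ₀ ^ 2 * |U u| ^ 2 + u * (1 / (starDeriv B * ρ₀ ^ 2) + 3 / ρ₀ ^ 2) +
      (200000 * u * (stepSize S u * ρ₀ + u) / (starDeriv B * ρ₀ ^ 4) + 8 / ρ₀ ^ 3 * |U u| ^ 3 +
        6144 / ρ₀ ^ 3 * u * |U u|) ≤
      stepK δ₀ ρ₀ * (|U u| ^ 2 + u + (u * stepSize S u + u ^ 2 + |U u| ^ 3 + u * |U u|)) := by
    have e1 : 2 / ρ₀ ^ 2 * |U u| ^ 2 ≤ stepK δ₀ ρ₀ * |U u| ^ 2 := mul_le_mul_of_nonneg_right hK2 (by positivity)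
    have e2 : (u : ℝ) * (1 / (starDeriv B * ρ₀ ^ 2) + 3 / ρ₀ ^ 2) ≤ stepK δ₀ ρ₀ * u := by
      rw [mul_comm]
      refine mul_le_mul_of_nonneg_right ?_ hu0
      have f1 : 1 / (starDeriv B * ρ₀ ^ 2) ≤ 1 / (δ₀ * ρ₀ ^ 2) :=
        one_div_le_one_div_of_le (by positivity) (mul_le_mul_of_nonneg_right hδ (by positivity))
      have f2 : 1 / (δ₀ * ρ₀ ^ 2) + 3 / ρ₀ ^ 2 ≤ 4 / (δ₀ * ρ₀ ^ 2) := by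
        have : 3 / ρ₀ ^ 2 ≤ 3 / (δ₀ * ρ₀ ^ 2) :=
          div_le_div_of_nonneg_left (by norm_num) (by positivity) (mul_le_of_le_one_left (by positivity) hδ1)
        have f3 : 1 / (δ₀ * ρ₀ ^ 2) + 3 / (δ₀ * ρ₀ ^ 2) = 4 / (δ₀ * ρ₀ ^ 2) := by ring
        linarith only [this, f3]
      linarith only [f1, f2, hK4]
    have e3 : stepK δ₀ ρ₀ * (|U u| ^ 2 + u + (u * stepSize S u + u ^ 2 + |U u| ^ 3 + u * |U u|)) =
        stepK δ₀ ρ₀ * |U u| ^ 2 + stepK δ₀ ρ₀ * u + stepK δ₀ ρ₀ * (u * stepSize S u + u ^ 2 + |U u| ^ 3 + u * |U u|) := by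
      ring
    linarith only [e1, e2, e3, hRK]
  have hKa : min (stepK δ₀ ρ₀ * (|U u| + u + (u * stepSize S u + u ^ 2 + |U u| ^ 3 + u * |U u|))) (starDeriv B / 2) +
      |U u| / ρ₀ ≤
      min (stepK δ₀ ρ₀ * (|U u| + u + (u * stepSize S u + u ^ 2 + |U u| ^ 3 + u * |U u|))) (starDeriv B / 2) +
      stepK δ₀ ρ₀ * |U u| := by
    have : |U u| / ρ₀ = 1 / ρ₀ * |U u| := by ring
    rw [this]; exact add_le_add le_rfl (mul_le_mul_of_nonneg_right hKρ ha0)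
  have hβ0 : 0 ≤ min (stepK δ₀ ρ₀ * (|U u| + u + (u * stepSize S u + u ^ 2 + |U u| ^ 3 + u * |U u|))) (starDeriv B / 2) :=
    le_min (by positivity) (by positivity)
  have hmono := mul_le_mul_of_nonneg_left hKa hI0
  have hd118 : 0 ≤ 15 / 128 * starDeriv B ^ (-(11 / 8 : ℝ)) := by positivity
  have hmono2 := mul_le_mul_of_nonneg_left hmono hd118
  have pure := stepModel_rhs_le (d := starDeriv B) hK1 ha0 hu0 hu1 hη0.le hη1 hUu hR0 hRK hβ0 (min_le_left _ _) hI0 hI hδ0 hδ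
  linarith only [key, hmono2, pure]

end Loewner

end Literature.Probability.RandomPlanarGeometry
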